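import Summits.NavierStokesRegularity.NavierStokesRegularity.Theorems.StretchingWellBindingEnstrophyQuarterLawDensitySieveCount
import Summits.NavierStokesRegularity.NavierStokesRegularity.Theorems.StretchingWellBindingEnstrophyQuarterLawDensitySieveDyadic
import HarnessLib

/-!
# Shelf crux `EnstrophyQuarterLaw` (stmt-NavierStokesRegularity-1574): the ONE-SLICE theorem of a density sieve

Helper file (`--supports stmt-NavierStokesRegularity-1574 --as helper`; def-free; seat leafhand-ns-efficiencyfloor-4
g10; composes `…DensitySieveCount` (p832059) and `…DensitySieveDyadic` (p832103)). For ONE slice `v` (standing for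
`u(t₀,·)` of a hypothetical first blow-up) on a metric measure space with cubic ball growth `μ B(x,s) ≤ v₁ s³`, and a
nonnegative size function `G` (standing for `|∇u(t₀,·)|`), assume
* the weak-`L³` tail `μ{‖v‖ > ε/r} ≤ (M r/ε)³` at the heights `ε/r`, `0 < r ≤ r₀` (i.e. `‖v‖_{L^{3,w}} ≤ M`);
* a sup bound `‖v‖ ≤ U` (for a first blow-up: the sup-rate Type-I bound `U = M₁ (T − t₀)^{-1/2}`, stmt-0056);
* SLICE ε-REGULARITY in the form a density-sieve line must supply [cite: ChoeWolfYang2019, Thm 1 with Lemma 8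
  (19), Lemma 9, (26)]: if `B(x,r)` is NOT density-bad, `¬ (ε r³ ≤ μ({‖v‖ > ε/r} ∩ B(x,r)))`, then `G x ≤ C/r²`.
Then on every measurable `A` (`setLIntegral_sq_le_of_densitySieve`):
`∫_A G² dμ ≤ (C²/r₀⁴) μ A + 16 C² (8 v₁ M³/ε⁴) (1/r₀ + 2U/ε)` — LINEAR IN THE SUP BOUND `U`. Mechanism: dyadic
scales `r_k = r₀ 2^{-k}` down to the first `K` with `r₀ U ≤ ε 2^K` (there every ball is good since the level set
`{‖v‖ > ε/r_K}` is empty); at each scale the bad set is covered by `≤ M³/ε⁴` doubled balls (Chebyshev + Vitali,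
`exists_finite_cover_densityBad`), so `μ D_k ≤ (8 v₁ M³/ε⁴) r_k³` uniformly; the stopping-scale assembly
`setLIntegral_le_of_dyadic_sieve` sums the geometric series. With `U ≍ (T − t₀)^{-1/2}` this is the quarter-rate
SHAPE `Z(t₀) ≲ A + B (T − t₀)^{-1/2}` of the crux, for the near field.

HONEST FRAMING: a theorem about one function on an abstract metric measure space; the Navier–Stokes inputs (the
`L^{3,w}` bound along the flow, the sup-rate Type-I bound, the slice ε-regularity, the far field) are HYPOTHESES here
and OPEN / unformalised for a first blow-up; no registered stub of line «sparse_sieve» is closed, the crux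
`EnstrophyQuarterLaw` stays OPEN and no summit statement is proved. [folklore]
-/

noncomputable section

-- the summit and its single sub-problem share the name (CONVENTIONS §1), as in every Theorems file
set_option linter.dupNamespace false

namespace Summit.NavierStokesRegularity.NavierStokesRegularity.Theorems.EnstrophyQuarterLaw.DensitySieve

open MeasureTheory Set Metric
open scoped ENNReal

/-- At a scale `r` with `r U ≤ ε` nothing is density-bad for a slice bounded by `U`: the level set
`{‖v‖ > ε/r}` is empty, so `ε r³ ≤ μ(∅ ∩ B) = 0` fails. [folklore] -/
theorem not_densityBad_of_sup_le {α : Type*} [PseudoMetricSpace α] [MeasurableSpace α] (μ : Measure α)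
    {β : Type*} [NormedAddCommGroup β] (v : α → β) {ε r U : ℝ} (hε : 0 < ε) (hr : 0 < r)
    (hsup : ∀ y, ‖v y‖ ≤ U) (hrU : r * U ≤ ε) (x : α) :
    ¬ (ENNReal.ofReal (ε * r ^ 3) ≤ μ ({y | ε / r < ‖v y‖} ∩ Metric.ball x r)) := by
  have hempty : {y | ε / r < ‖v y‖} = ∅ := by
    ext y
    simp only [Set.mem_setOf_eq, Set.mem_empty_iff_false, iff_false, not_lt]
    rw [le_div_iff₀ hr]
    calc ‖v y‖ * r ≤ U * r := mul_le_mul_of_nonneg_right (hsup y) hr.le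
      _ = r * U := mul_comm _ _
      _ ≤ ε := hrU
  rw [hempty, Set.empty_inter, measure_empty, nonpos_iff_eq_zero, ENNReal.ofReal_eq_zero, not_le]
  positivity

/-- **The one-slice theorem of the density sieve.** See the module docstring: weak-`L³` tail at heights `ε/r`
(`r ≤ r₀`), sup bound `U`, slice ε-regularity `¬bad(x,r) ⟹ G x ≤ C/r²`, cubic ball growth `μ B(x,s) ≤ v₁ s³`;
then `∫_A G² ≤ (C²/r₀⁴) μ A + 16 C² (8 v₁ M³/ε⁴)(1/r₀ + 2U/ε)`, linear in `U`. [cite: ChoeWolfYang2019, Thm 1–2] -/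
theorem setLIntegral_sq_le_of_densitySieve {α : Type*} [PseudoMetricSpace α] [MeasurableSpace α]
    [OpensMeasurableSpace α] (μ : Measure α) {β : Type*} [NormedAddCommGroup β] (v : α → β) (G : α → ℝ)
    {M ε C U r₀ v₁ : ℝ} (hM : 0 ≤ M) (hε : 0 < ε) (hU : 0 < U) (hr₀ : 0 < r₀) (hv₁ : 0 ≤ v₁)
    (hball : ∀ (x : α) (s : ℝ), 0 < s → μ (Metric.ball x s) ≤ ENNReal.ofReal (v₁ * s ^ 3))
    (htail : ∀ r ∈ Set.Ioc 0 r₀, μ {y | ε / r < ‖v y‖} ≤ ENNReal.ofReal ((M * r / ε) ^ 3))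
    (hsup : ∀ y, ‖v y‖ ≤ U)
    (hreg : ∀ (x : α), ∀ r ∈ Set.Ioc 0 r₀,
      ¬ (ENNReal.ofReal (ε * r ^ 3) ≤ μ ({y | ε / r < ‖v y‖} ∩ Metric.ball x r)) → G x ≤ C / r ^ 2)
    (hG : ∀ x, 0 ≤ G x) (A : Set α) (hA : MeasurableSet A) :
    ∫⁻ x in A, ENNReal.ofReal (G x ^ 2) ∂μ ≤
      ENNReal.ofReal (C ^ 2 / r₀ ^ 4) * μ A +
        ENNReal.ofReal (16 * C ^ 2 * (8 * v₁ * M ^ 3 / ε ^ 4) * (1 / r₀ + 2 * U / ε)) := by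
  classical
  -- the finest scale: the first `K` with `r₀ U ≤ ε 2^K`
  have hexK : ∃ K : ℕ, r₀ * U ≤ ε * 2 ^ K := by
    obtain ⟨n, hn⟩ := pow_unbounded_of_one_lt (r₀ * U / ε) (by norm_num : (1 : ℝ) < 2)
    exact ⟨n, by rw [div_lt_iff₀ hε] at hn; linarith⟩
  obtain ⟨K, hK, hKmin⟩ : ∃ K : ℕ, r₀ * U ≤ ε * 2 ^ K ∧ ∀ m < K, ¬ (r₀ * U ≤ ε * 2 ^ m) :=
    ⟨Nat.find hexK, Nat.find_spec hexK, fun m hm => Nat.find_min hexK hm⟩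
  have hKbound : (2 : ℝ) ^ K / r₀ ≤ 1 / r₀ + 2 * U / ε := by
    rcases Nat.eq_zero_or_pos K with hK0 | hKpos
    · subst hK0
      have : 0 ≤ 2 * U / ε := by positivity
      simpa using this
    · obtain ⟨m, rfl⟩ : ∃ m, K = m + 1 := Nat.exists_eq_succ_of_ne_zero hKpos.ne'
      have hm := hKmin m (by omega)
      rw [not_le] at hm
      have h1 : (2 : ℝ) ^ (m + 1) / r₀ ≤ 2 * U / ε := by
        rw [div_le_div_iff₀ hr₀ hε, pow_succ]
        nlinarith
      have h2 : (0 : ℝ) ≤ 1 / r₀ := by positivity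
      linarith
  -- the scales
  set r : ℕ → ℝ := fun k => r₀ / 2 ^ k with hr_def
  have hrpos : ∀ k, 0 < r k := fun k => by positivity
  have hrle : ∀ k, r k ≤ r₀ := fun k => div_le_self hr₀.le (one_le_pow₀ (by norm_num))
  have hrmem : ∀ k, r k ∈ Set.Ioc 0 r₀ := fun k => ⟨hrpos k, hrle k⟩
  -- the finite disjoint bad subfamilies and their doubled-ball covers
  have hcov := fun k => exists_finite_cover_densityBad μ v hM hε (hrpos k) (htail (r k) (hrmem k))
  choose S hSsub hSfin hScard _hSdisj hScov using hcov
  let D : ℕ → Set α := fun k => ⋃ x ∈ (hSfin k).toFinset, Metric.ball x (2 * r k)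
  have hDmeas : ∀ k, MeasurableSet (D k) := fun k =>
    Finset.measurableSet_biUnion _ fun _ _ => measurableSet_ball
  have hBadD : ∀ k, {x | ENNReal.ofReal (ε * r k ^ 3) ≤ μ ({y | ε / r k < ‖v y‖} ∩ Metric.ball x (r k))} ⊆ D k := by
    intro k y hy
    have hy' := hScov k hy
    simp only [Set.mem_iUnion] at hy'
    obtain ⟨x, hx, hyx⟩ := hy'
    simp only [D, Set.mem_iUnion]
    exact ⟨x, (hSfin k).mem_toFinset.2 hx, hyx⟩
  -- (i) good points: `G² ≤ C²/r_k⁴ = C² (2^k)⁴ / r₀⁴`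
  have hgood : ∀ k ≤ K, ∀ x ∈ A, x ∉ D k →
      ENNReal.ofReal (G x ^ 2) ≤ ENNReal.ofReal (C ^ 2 * (2 ^ k) ^ 4 / r₀ ^ 4) := by
    intro k _ x _ hxD
    have hnotbad : ¬ (ENNReal.ofReal (ε * r k ^ 3) ≤ μ ({y | ε / r k < ‖v y‖} ∩ Metric.ball x (r k))) :=
      fun hbad => hxD (hBadD k hbad)
    have hGx : G x ≤ C / r k ^ 2 := hreg x (r k) (hrmem k) hnotbad
    apply ENNReal.ofReal_le_ofReal
    have h2k : (0 : ℝ) < 2 ^ k := by positivity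
    calc G x ^ 2 ≤ (C / r k ^ 2) ^ 2 := pow_le_pow_left₀ (hG x) hGx 2
      _ = C ^ 2 * (2 ^ k) ^ 4 / r₀ ^ 4 := by
          simp only [hr_def]
          field_simp
  -- (ii) bad sets: `μ D_k ≤ (8 v₁ M³/ε⁴) r_k³ = m r₀³/(2^k)³`
  have hbad : ∀ k < K, μ (D k) ≤ ENNReal.ofReal (8 * v₁ * M ^ 3 / ε ^ 4 * r₀ ^ 3 / (2 ^ k) ^ 3) := by
    intro k _
    have hcard : (((hSfin k).toFinset.card : ℕ) : ℝ) ≤ M ^ 3 / ε ^ 4 := by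
      rw [← Set.ncard_eq_toFinset_card (S k) (hSfin k)]
      exact hScard k
    calc μ (D k) ≤ ∑ x ∈ (hSfin k).toFinset, μ (Metric.ball x (2 * r k)) :=
          measure_biUnion_finset_le _ _
      _ ≤ ∑ _x ∈ (hSfin k).toFinset, ENNReal.ofReal (v₁ * (2 * r k) ^ 3) :=
          Finset.sum_le_sum fun x _ => hball x (2 * r k) (by positivity)
      _ = ENNReal.ofReal (((hSfin k).toFinset.card : ℝ) * (v₁ * (2 * r k) ^ 3)) := by
          rw [Finset.sum_const, nsmul_eq_mul, ENNReal.ofReal_mul (Nat.cast_nonneg _), ENNReal.ofReal_natCast]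
      _ ≤ ENNReal.ofReal (M ^ 3 / ε ^ 4 * (v₁ * (2 * r k) ^ 3)) := by
          apply ENNReal.ofReal_le_ofReal
          exact mul_le_mul_of_nonneg_right hcard (by positivity)
      _ = ENNReal.ofReal (8 * v₁ * M ^ 3 / ε ^ 4 * r₀ ^ 3 / (2 ^ k) ^ 3) := by
          congr 1
          simp only [hr_def]
          have h2k : (0 : ℝ) < 2 ^ k := by positivity
          field_simp
          ring
  -- (iii) at the finest scale nothing is bad: `S K = ∅`, so `D K = ∅`
  have hrKU : r K * U ≤ ε := by
    simp only [hr_def]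
    rw [div_mul_eq_mul_div, div_le_iff₀ (by positivity)]
    exact hK
  have hlast : ∀ x ∈ A, x ∉ D K := by
    intro x _ hx
    simp only [D, Set.mem_iUnion] at hx
    obtain ⟨y, hy, -⟩ := hx
    have hybad := hSsub K ((hSfin K).mem_toFinset.1 hy)
    exact not_densityBad_of_sup_le μ v hε (hrpos K) hsup hrKU y hybad
  -- assemble
  have hm : (0 : ℝ) ≤ 8 * v₁ * M ^ 3 / ε ^ 4 := by positivity
  have key := setLIntegral_le_of_dyadic_sieve μ A hA (fun x => ENNReal.ofReal (G x ^ 2)) K D hDmeas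
    (sq_nonneg C) hm hr₀ hgood hbad hlast
  refine key.trans (add_le_add le_rfl (ENNReal.ofReal_le_ofReal ?_))
  have hpre : 0 ≤ 16 * C ^ 2 * (8 * v₁ * M ^ 3 / ε ^ 4) := by positivity
  calc 16 * C ^ 2 * (8 * v₁ * M ^ 3 / ε ^ 4) * 2 ^ K / r₀
      = 16 * C ^ 2 * (8 * v₁ * M ^ 3 / ε ^ 4) * (2 ^ K / r₀) := by ring
    _ ≤ 16 * C ^ 2 * (8 * v₁ * M ^ 3 / ε ^ 4) * (1 / r₀ + 2 * U / ε) :=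
        mul_le_mul_of_nonneg_left hKbound hpre

end Summit.NavierStokesRegularity.NavierStokesRegularity.Theorems.EnstrophyQuarterLaw.DensitySieve

end
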